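import Summits.ResolutionOfSingularities.ResolutionOfSingularities.Theorems.PurelyInseparableDim4ResConeTiltedLoseBoth
import HarnessLib
import HarnessLib.Audit.Tags

/-!
# Purely inseparable four-folds — THE `(2,1)`-STATES OF A TILTED BINARY-CONE TAIL in the moving frame: the corner
# step, the keep step, and the two lose-both kills (K2(p) lane, SLICE C, brick (ii) «tilted reduction», FILE 3d-α;
# file-holder res-dim4-p-5 g4)

[OURS · counted 0 · cell `res-dim4-pi` · K2(p) lane, slice C (desk WORD #155) · seat p-5 g4.]
Nothing here proves K2(p)/K2(5), `NoIsolatedTrap p p` or resolution of singularities in dimension ≥ 4 / char. `p`.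

SETTING of `…TiltedLoseBoth` at a HALF-STRAIGHT `(2,1)`-state `m` of the tail: `r_m = 2e_a + e_{a′}`,
`e_{a′} ∈ Vtx(c m)` on the nose, `e_a + φ ∈ Vtx(c m)` (`φ` on the inert letters); `G = shear a φ F_m` is the cone
read in the frame.  One step from such a state:
* `straight_rows` — the degree-`7` rows of `G` are `x_a²x_{a′}·(inert quartic-free cubic)` (`inert_of_straighten`);
* `false_of_keep` — chart `a′` keeping `a` gives the non-isolated `(2,2)` child;
* **`corner_frame_step`** — chart `a` with `b m a′ = 0` is the corner `T_a` AT THE FRAME POINT `b m = φ`; the child is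
  again a `(2,1)`-state, `e_{a′}` persists, a new `a`-tilt `φ₁` exists, and the straightened child
  `shear a φ₁ F_{m+1}` is the chart image of the JET `J_{φ₁} G` (3a `coeff_step_frame` with `t = 0`);
* **`loseBoth_jet_kill`** / **`loseBoth_jet_kill_swap`** — a lose-both step in either orientation forces
  `coeff_{(4,5)} G = coeff_{(4,4)} G = 0`: the package's (D1)/(row) identities speak about `J G` (resp. `J′ G`, jet
  along `a′`), and the package's OWN (D1) kills the one-inert-letter sources `(2,5,e_i)` (resp. `(4,3,e_i)`), so
  `coeff_jet_eq_of_noSource` transfers them to `G` (marker robustness (Q)).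
[cite: CossartJannsenSaito2020, Thm. 3.14, Lemma 13.2, Thm. 13.7] [cite: Hauser2010, §I (definition of P⁺, kangaroo phenomenon)]
bears_on: LADDER-RESOLUTION:D157-DOOR2 (res-dim4-pi · K2(p) = `RidgeBudget.NoAboveFloorTrap p p` · slice C, tilted residual).
Supports stmt-ResolutionOfSingularities-16155 (helper).
-/

set_option linter.dupNamespace false -- mandated namespace of this single-conjunct summit

noncomputable section

namespace Summit.ResolutionOfSingularities.ResolutionOfSingularities.Theorems.PIDim4

namespace ResCone

open MvPolynomial Finset
open Literature.AlgebraicGeometry.Resolution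
open Literature.AlgebraicGeometry.Resolution.CentreBlowup
open Literature.AlgebraicGeometry.Resolution.Hauser2010
open Literature.AlgebraicGeometry.Resolution.HauserPerlega2019
open PointBlowup (direction)

variable {K : Type} [Field K] [CharP K 5] [DecidableEq K]

section TiltedCorner

/-- **THE ROWS OF A HALF-STRAIGHT `(2,1)`-STATE**: in the frame `shear a φ`, every monomial of `F_m` has degree
`≥ 7` and the degree-`7` ones are `x_a² x_{a′} · (inert cubic)`. [OURS] [cite: CossartJannsenSaito2020, Def. 2.8, Thm. 3.14] -/
theorem straight_rows {c : ℕ → State K}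
    (hc : ∀ k, IsIsolated 5 (c k).F ∧ Step0 5 (c k) (c (k + 1)))
    (hr0 : ∀ e ∈ (c 0).F.support, (c 0).r ≤ e) (hfloor : ∀ k, ordZero (c k).F ≠ 5) {k₀ : ℕ}
    (hshade : ∀ k, k₀ ≤ k → (c k).shade = ((4 : ℕ) : ℕ∞)) {a a' : Fin 4} (haa : a ≠ a')
    (hpass : ∀ k, k₀ ≤ k → ∀ i, i ≠ a → i ≠ a' → (c k).r i = 0)
    {m : ℕ} (hm : k₀ ≤ m) (hrm : (c m).r = Finsupp.single a 2 + Finsupp.single a' 1)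
    (hVa' : (Pi.single a' 1 : Fin 4 → K) ∈ resVertex (c m)) {φ : Fin 4 → K} (hφa : φ a = 0) (hφa' : φ a' = 0)
    (hφV : (Pi.single a 1 : Fin 4 → K) + φ ∈ resVertex (c m)) :
    ∀ e ∈ (shear a φ (c m).F).support, 7 ≤ e.degree ∧ (e.degree = 7 → e a = 2 ∧ e a' = 1) := by
  haveI : Fact (Nat.Prime 5) := ⟨by norm_num⟩
  obtain ⟨o, ho, hosum, -, -, hrk, -⟩ := chain_basics hc hr0 hfloor hshade haa hpass hm
  have hra : (c m).r a = 2 := by rw [hrm, two_apply haa, if_pos rfl]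
  have hra' : (c m).r a' = 1 := by rw [hrm, two_apply haa, if_neg haa.symm, if_pos rfl]
  have ho7 : o = 7 := by omega
  have h := inert_of_straighten 5 ho (by rw [ordZero_sub_degree_eq_of_shade ho (hshade m hm)]; norm_num) hrk haa
    (hpass m hm) hφa hφa' (Ψ := 0) rfl rfl hφV (by rw [add_zero]; exact hVa')
  rw [shear_zero] at h
  intro e he
  obtain ⟨-, h7, h7eq⟩ := h e he
  exact ⟨ho7 ▸ h7, fun hd => by have := h7eq (hd.trans ho7.symm); rwa [hra, hra'] at this⟩

omit [CharP K 5] in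
/-- **KEEPING `a` IN THE CHART `a′` IS IMPOSSIBLE** from a `(2,1)`-state: the child would carry `x_a²x_{a′}²`
(pair sum `4 > 3`: not isolated). [OURS] [cite: CossartJannsenSaito2020, Thm. 13.7] -/
theorem false_of_keep {c : ℕ → State K} {j : ℕ → Fin 4} {b : ℕ → Fin 4 → K}
    (hc : ∀ k, IsIsolated 5 (c k).F ∧ Step0 5 (c k) (c (k + 1))) (hw : FreeTail.IsWitnessedChain 5 c j b)
    (hr0 : ∀ e ∈ (c 0).F.support, (c 0).r ≤ e) (hfloor : ∀ k, ordZero (c k).F ≠ 5) {k₀ : ℕ}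
    (hshade : ∀ k, k₀ ≤ k → (c k).shade = ((4 : ℕ) : ℕ∞)) {a a' : Fin 4} (haa : a ≠ a')
    (hpass : ∀ k, k₀ ≤ k → ∀ i, i ≠ a → i ≠ a' → (c k).r i = 0)
    {m : ℕ} (hm : k₀ ≤ m) (hrm : (c m).r = Finsupp.single a 2 + Finsupp.single a' 1)
    (hja' : j m = a') (htm : b m a = 0) : False := by
  obtain ⟨o, ho, hosum, -, -, hrk, -⟩ := chain_basics hc hr0 hfloor hshade haa hpass hm
  have hra : (c m).r a = 2 := by rw [hrm, two_apply haa, if_pos rfl]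
  have hra' : (c m).r a' = 1 := by rw [hrm, two_apply haa, if_neg haa.symm, if_pos rfl]
  obtain ⟨o₁, -, -, hpair₁, -, -, -⟩ := chain_basics hc hr0 hfloor hshade haa hpass (k := m + 1) (by omega)
  have law := step_r_univ 5 (j m) (hw m).2.1 (c m) ho hrk
  rw [← (hw m).2.2.2.2, hja'] at law
  have h1a' : (c (m + 1)).r a' = o - 5 := by rw [law, Finsupp.coe_update, Function.update_self]
  have h1a : (c (m + 1)).r a = 2 := by
    rw [law, Finsupp.coe_update, Function.update_of_ne haa, Finsupp.filter_apply, if_pos htm, hra]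
  omega

/-- **THE CORNER STEP IN THE MOVING FRAME.**  From a half-straight `(2,1)`-state, a step with chart `a` not
translating `a′` is the corner `T_a` at the frame point `b m = φ` (`translation_forced`); the child is again a
`(2,1)`-state with `e_{a′} ∈ Vtx` (`tilt_persists`), it has an `a`-tilt `φ₁` (`exists_tilted_frame`), and its
straightening `shear a φ₁ F_{m+1}` is, coefficientwise off the `5`-th-power lattice, the chart image of the inert jet
`J_{φ₁} (shear a φ F_m)` (3a `coeff_step_frame` with `t = 0`, `aeval_frame_eq_jet`). [OURS]
[cite: Hauser2010, §I (definition of P⁺)] [cite: CossartJannsenSaito2020, Thm. 3.14] -/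
theorem corner_frame_step {c : ℕ → State K} {j : ℕ → Fin 4} {b : ℕ → Fin 4 → K}
    (hc : ∀ k, IsIsolated 5 (c k).F ∧ Step0 5 (c k) (c (k + 1))) (hw : FreeTail.IsWitnessedChain 5 c j b)
    (hr0 : ∀ e ∈ (c 0).F.support, (c 0).r ≤ e) (hfloor : ∀ k, ordZero (c k).F ≠ 5) {k₀ : ℕ}
    (hshade : ∀ k, k₀ ≤ k → (c k).shade = ((4 : ℕ) : ℕ∞))
    (he : ∀ k, k₀ ≤ k → Module.finrank K (resVertex (c k)) = 2) {a a' : Fin 4} (haa : a ≠ a')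
    (hletters : ∀ k, k₀ ≤ k → (j k = a ∨ j k = a'))
    (hpass : ∀ k, k₀ ≤ k → ∀ i, i ≠ a → i ≠ a' → (c k).r i = 0)
    {m : ℕ} (hm : k₀ ≤ m) (hrm : (c m).r = Finsupp.single a 2 + Finsupp.single a' 1)
    (hVa' : (Pi.single a' 1 : Fin 4 → K) ∈ resVertex (c m)) {φ : Fin 4 → K} (hφa : φ a = 0) (hφa' : φ a' = 0)
    (hφV : (Pi.single a 1 : Fin 4 → K) + φ ∈ resVertex (c m)) (hja : j m = a) (htm : b m a' = 0) :
    b m = φ ∧ (c (m + 1)).r = Finsupp.single a 2 + Finsupp.single a' 1 ∧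
    (Pi.single a' 1 : Fin 4 → K) ∈ resVertex (c (m + 1)) ∧
    ∃ φ₁ : Fin 4 → K, φ₁ a = 0 ∧ φ₁ a' = 0 ∧ (Pi.single a 1 : Fin 4 → K) + φ₁ ∈ resVertex (c (m + 1)) ∧
      ∀ e : Fin 4 →₀ ℕ, 5 ≤ e.degree → ¬ IsPthPowerExponent 5 (chartExponent 5 Finset.univ a e) →
        coeff (chartExponent 5 Finset.univ a e) (shear a φ₁ (c (m + 1)).F) =
          coeff e (aeval (fun i => (X i : MvPolynomial (Fin 4) K) + C (φ₁ i) * X a ^ 2) (shear a φ (c m).F)) := by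
  haveI : Fact (Nat.Prime 5) := ⟨by norm_num⟩
  obtain ⟨o, ho, hosum, -, -, hrk, -⟩ := chain_basics hc hr0 hfloor hshade haa hpass hm
  have hra : (c m).r a = 2 := by rw [hrm, two_apply haa, if_pos rfl]
  have hra' : (c m).r a' = 1 := by rw [hrm, two_apply haa, if_neg haa.symm, if_pos rfl]
  have hψV : (Pi.single a' 1 : Fin 4 → K) + (0 : Fin 4 → K) ∈ resVertex (c m) := by rw [add_zero]; exact hVa'
  have hbm : b m = φ := by
    funext i
    by_cases hia' : i = a'
    · rw [hia', htm, hφa']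
    · by_cases hia : i = a
      · rw [hia, hφa, ← hja]; exact (hw m).2.1
      · rw [translation_forced 5 hc hw hr0 hfloor hshade he haa hletters hm hja hφa hφa' (ψ := 0) rfl rfl hφV hψV
          hia hia', htm, Pi.zero_apply, mul_zero, add_zero]
  have hstep : c (m + 1) = CentreBlowup.step 5 Finset.univ a φ (c m) := by rw [(hw m).2.2.2.2, hja, hbm]
  have law := step_r_univ 5 a (b := φ) hφa (c m) ho hrk
  rw [← hstep] at law
  have hr1 : (c (m + 1)).r = Finsupp.single a 2 + Finsupp.single a' 1 := by
    ext i
    rw [law, Finsupp.coe_update, hrm, two_apply haa]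
    by_cases hia : i = a
    · rw [hia, Function.update_self, if_pos rfl]; omega
    · rw [Function.update_of_ne hia, Finsupp.filter_apply, two_apply haa, if_neg hia]
      by_cases hia' : i = a'
      · rw [if_pos hia', hia', if_pos hφa']
      · rw [if_neg hia']; split_ifs <;> rfl
  have hVa'1 : (Pi.single a' 1 : Fin 4 → K) ∈ resVertex (c (m + 1)) :=
    tilt_persists 5 hc hw hr0 hfloor hshade he hm hVa' (by rw [hja, Pi.single_eq_of_ne haa])
  obtain ⟨φ₁, -, hφ₁a, hφ₁a', -, -, hφ₁V, -⟩ :=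
    exists_tilted_frame 5 hc hw hr0 hfloor hshade he haa hletters (k := m + 1) (by omega)
  have hstep' : c (m + 1) =
      CentreBlowup.step 5 Finset.univ a ((Pi.single a' (0 : K) : Fin 4 → K) + φ + (0 : K) • (0 : Fin 4 → K)) (c m) := by
    rw [Pi.single_zero, zero_add, smul_zero, add_zero]; exact hstep
  refine ⟨hbm, hr1, hVa'1, φ₁, hφ₁a, hφ₁a', hφ₁V, fun e h5e hnp => ?_⟩
  have h := coeff_step_frame haa (0 : K) φ (0 : Fin 4 → K) φ₁ hφa hφa' rfl rfl hφ₁a hφ₁a' (c m) (hw m).1 h5e hnp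
  rw [← hstep', shear_zero, Pi.single_zero, shear_zero, aeval_frame_eq_jet haa hφa hφa' rfl rfl hφ₁a hφ₁a',
    shear_zero] at h
  exact h

/-- `(u e_a + v e_{a′}) + (u′ e_a + v′ e_{a′})` evaluated. [folklore] -/
theorem two_add_two_apply {a a' : Fin 4} (haa : a ≠ a') (u v u' v' : ℕ) (i : Fin 4) :
    (Finsupp.single a u + Finsupp.single a' v + (Finsupp.single a u' + Finsupp.single a' v') : Fin 4 →₀ ℕ) i =
      if i = a then u + u' else if i = a' then v + v' else 0 := by
  rw [Finsupp.add_apply, two_apply haa, two_apply haa]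
  split_ifs <;> rfl

/-- **LOSE-BOTH `(a, a′)` FROM A HALF-STRAIGHT `(2,1)`-STATE KILLS BOTH MARKERS**: if step `m` has chart `a` and
translates `a′`, then in the frame `G = shear a φ F_m`: `coeff_{x_a⁴x_{a′}⁵} G = 0` and `coeff_{x_a⁴x_{a′}⁴} G = 0`.
The package (`ψ = 0`) gives these for the jet `J_{φ′} G`; its (D1) kills the one-inert-letter sources
`x_a²x_{a′}⁵x_i` of `J`, and `coeff_jet_eq_of_noSource` transfers. [OURS]
[cite: CossartJannsenSaito2020, Lemma 13.2, Thm. 13.7] [cite: Hauser2010, §I (kangaroo phenomenon)] -/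
theorem loseBoth_jet_kill {c : ℕ → State K} {j : ℕ → Fin 4} {b : ℕ → Fin 4 → K}
    (hc : ∀ k, IsIsolated 5 (c k).F ∧ Step0 5 (c k) (c (k + 1))) (hw : FreeTail.IsWitnessedChain 5 c j b)
    (hr0 : ∀ e ∈ (c 0).F.support, (c 0).r ≤ e) (hfloor : ∀ k, ordZero (c k).F ≠ 5) {k₀ : ℕ}
    (hshade : ∀ k, k₀ ≤ k → (c k).shade = ((4 : ℕ) : ℕ∞))
    (he : ∀ k, k₀ ≤ k → Module.finrank K (resVertex (c k)) = 2) {a a' : Fin 4} (haa : a ≠ a')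
    (hletters : ∀ k, k₀ ≤ k → (j k = a ∨ j k = a'))
    (hpass : ∀ k, k₀ ≤ k → ∀ i, i ≠ a → i ≠ a' → (c k).r i = 0)
    {m : ℕ} (hm : k₀ ≤ m) (hrm : (c m).r = Finsupp.single a 2 + Finsupp.single a' 1)
    (hVa' : (Pi.single a' 1 : Fin 4 → K) ∈ resVertex (c m)) {φ : Fin 4 → K} (hφa : φ a = 0) (hφa' : φ a' = 0)
    (hφV : (Pi.single a 1 : Fin 4 → K) + φ ∈ resVertex (c m)) (hja : j m = a) (ht : b m a' ≠ 0) :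
    coeff (Finsupp.single a 4 + Finsupp.single a' 5) (shear a φ (c m).F) = 0 ∧
      coeff (Finsupp.single a 4 + Finsupp.single a' 4) (shear a φ (c m).F) = 0 := by
  have hG7 := straight_rows hc hr0 hfloor hshade haa hpass hm hrm hVa' hφa hφa' hφV
  obtain ⟨φ', hφ'a, hφ'a', -, -, -, -, h8, h9, -, -, -⟩ := tilted_loseBoth_package hc hw hr0 hfloor hshade he haa
    hletters hpass hm hja ht hφa hφa' (ψ := 0) rfl rfl hφV (by rw [add_zero]; exact hVa')
  have hJ : aeval (fun i => (X i : MvPolynomial (Fin 4) K) + C (φ i) * X a + C ((0 : Fin 4 → K) i) * X a' +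
      C (φ' i) * X a ^ 2) (c m).F =
      aeval (fun i => (X i : MvPolynomial (Fin 4) K) + C (φ' i) * X a ^ 2) (shear a φ (c m).F) := by
    rw [aeval_frame_eq_jet haa hφa hφa' rfl rfl hφ'a hφ'a', shear_zero]
  -- the one-inert-letter sources vanish
  have h25 : ∀ i, i ≠ a → i ≠ a' →
      coeff (Finsupp.single a 2 + Finsupp.single a' 5 + Finsupp.single i 1) (shear a φ (c m).F) = 0 := by
    intro i hia hia'
    have hdeg : (Finsupp.single a 2 + Finsupp.single a' 5 + Finsupp.single i 1 : Fin 4 →₀ ℕ).degree = 8 := by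
      rw [map_add, map_add, Finsupp.degree_single, Finsupp.degree_single, Finsupp.degree_single]
    have hMa : (Finsupp.single a 2 + Finsupp.single a' 5 + Finsupp.single i 1 : Fin 4 →₀ ℕ) a = 2 := by
      rw [Finsupp.add_apply, two_apply haa, if_pos rfl, Finsupp.single_apply, if_neg hia, add_zero]
    have hMa' : (Finsupp.single a 2 + Finsupp.single a' 5 + Finsupp.single i 1 : Fin 4 →₀ ℕ) a' = 5 := by
      rw [Finsupp.add_apply, two_apply haa, if_neg haa.symm, if_pos rfl, Finsupp.single_apply, if_neg hia', add_zero]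
    have hκ : degIn ((Finset.univ.erase a).erase a') (Finsupp.single a 2 + Finsupp.single a' 5 + Finsupp.single i 1) = 1 := by
      have := degree_eq_apply_add_apply_add_degIn haa (Finsupp.single a 2 + Finsupp.single a' 5 + Finsupp.single i 1)
      omega
    have h := h8 _ hdeg hκ.le
    rw [hJ, coeff_jet_eq_of_noSource haa φ' hφ'a hφ'a' (fun e he hlt hd hc => by
      rw [hdeg] at hlt hc; rw [hMa'] at hd; rw [hMa] at hc
      obtain ⟨h7, h7eq⟩ := hG7 e he
      have := (h7eq (by omega)).1; omega)] at h
    exact h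
  have hdeg45 : (Finsupp.single a 4 + Finsupp.single a' 5 : Fin 4 →₀ ℕ).degree = 9 := by
    rw [map_add, Finsupp.degree_single, Finsupp.degree_single]
  have hdeg44 : (Finsupp.single a 4 + Finsupp.single a' 4 : Fin 4 →₀ ℕ).degree = 8 := by
    rw [map_add, Finsupp.degree_single, Finsupp.degree_single]
  refine ⟨?_, ?_⟩
  · have h := h9 4 (by norm_num) le_rfl
    have hexp : (c m).r + (Finsupp.single a (6 - 4) + Finsupp.single a' 4) =
        Finsupp.single a 4 + Finsupp.single a' 5 := by
      ext l; rw [hrm, two_add_two_apply haa, two_apply haa]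
    rw [hexp, hJ, coeff_jet_eq_of_noSource haa φ' hφ'a hφ'a' (fun e he hlt hd hc => by
      rw [hdeg45] at hlt hc; rw [two_apply haa, if_neg haa.symm, if_pos rfl] at hd
      rw [two_apply haa, if_pos rfl] at hc
      obtain ⟨h7, h7eq⟩ := hG7 e he
      by_cases h8e : e.degree = 8
      · have hea : e a = 2 := by omega
        have hsplit := degree_eq_apply_add_apply_add_degIn haa e
        obtain ⟨i, hia, hia', hei⟩ := eq_pair_add_single_of_degIn_eq_one haa (e := e) (by omega)
        rw [hea, ← hd] at hei
        exact (MvPolynomial.mem_support_iff.mp he) (by rw [hei]; exact h25 i hia hia')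
      · have := (h7eq (by omega)).1; omega)] at h
    exact h
  · have h := h8 _ hdeg44 (by rw [degIn_passive_pair]; omega)
    rw [hJ, coeff_jet_eq_of_noSource haa φ' hφ'a hφ'a' (fun e he hlt hd hc => by
      rw [hdeg44] at hlt hc; rw [two_apply haa, if_neg haa.symm, if_pos rfl] at hd
      obtain ⟨h7, h7eq⟩ := hG7 e he
      have := (h7eq (by omega)).2; omega)] at h
    exact h

/-- **LOSE-BOTH `(a′, a)` FROM A HALF-STRAIGHT `(2,1)`-STATE KILLS BOTH MARKERS TOO**: if step `m` has chart `a′`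
and translates `a`, the package WITH THE LETTERS SWAPPED (its frame: `e_{a′}` exact, `e_a + φ` tilted; its jet
`J′` is along `a′`) gives the row/`(D1)` identities for `J′ G`, its own (D1) kills the sources `x_a⁴x_{a′}³x_i`, and
`coeff_jet_eq_of_noSource` (letters swapped) transfers `coeff_{x_a⁴x_{a′}⁵} G = coeff_{x_a⁴x_{a′}⁴} G = 0`. [OURS]
[cite: CossartJannsenSaito2020, Lemma 13.2, Thm. 13.7] [cite: Hauser2010, §I (kangaroo phenomenon)] -/
theorem loseBoth_jet_kill_swap {c : ℕ → State K} {j : ℕ → Fin 4} {b : ℕ → Fin 4 → K}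
    (hc : ∀ k, IsIsolated 5 (c k).F ∧ Step0 5 (c k) (c (k + 1))) (hw : FreeTail.IsWitnessedChain 5 c j b)
    (hr0 : ∀ e ∈ (c 0).F.support, (c 0).r ≤ e) (hfloor : ∀ k, ordZero (c k).F ≠ 5) {k₀ : ℕ}
    (hshade : ∀ k, k₀ ≤ k → (c k).shade = ((4 : ℕ) : ℕ∞))
    (he : ∀ k, k₀ ≤ k → Module.finrank K (resVertex (c k)) = 2) {a a' : Fin 4} (haa : a ≠ a')
    (hletters : ∀ k, k₀ ≤ k → (j k = a ∨ j k = a'))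
    (hpass : ∀ k, k₀ ≤ k → ∀ i, i ≠ a → i ≠ a' → (c k).r i = 0)
    {m : ℕ} (hm : k₀ ≤ m) (hrm : (c m).r = Finsupp.single a 2 + Finsupp.single a' 1)
    (hVa' : (Pi.single a' 1 : Fin 4 → K) ∈ resVertex (c m)) {φ : Fin 4 → K} (hφa : φ a = 0) (hφa' : φ a' = 0)
    (hφV : (Pi.single a 1 : Fin 4 → K) + φ ∈ resVertex (c m)) (hja' : j m = a') (ht : b m a ≠ 0) :
    coeff (Finsupp.single a 4 + Finsupp.single a' 5) (shear a φ (c m).F) = 0 ∧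
      coeff (Finsupp.single a 4 + Finsupp.single a' 4) (shear a φ (c m).F) = 0 := by
  have hG7 := straight_rows hc hr0 hfloor hshade haa hpass hm hrm hVa' hφa hφa' hφV
  obtain ⟨φ', hφ'a', hφ'a, -, -, -, -, h8, h9, -, -, -⟩ := tilted_loseBoth_package hc hw hr0 hfloor hshade he haa.symm
    (fun k hk => (hletters k hk).symm) (fun k hk i h1 h2 => hpass k hk i h2 h1) hm hja' ht (φ := 0) (ψ := φ)
    rfl rfl hφa' hφa (by rw [add_zero]; exact hVa') hφV
  have hJ : aeval (fun i => (X i : MvPolynomial (Fin 4) K) + C ((0 : Fin 4 → K) i) * X a' + C (φ i) * X a +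
      C (φ' i) * X a' ^ 2) (c m).F =
      aeval (fun i => (X i : MvPolynomial (Fin 4) K) + C (φ' i) * X a' ^ 2) (shear a φ (c m).F) := by
    rw [aeval_frame_eq_jet haa.symm (Φ := 0) rfl rfl hφa' hφa hφ'a' hφ'a, shear_zero]
  have hPcomm : (Finset.univ.erase a').erase a = (Finset.univ.erase a).erase a' := Finset.erase_right_comm
  -- the one-inert-letter sources `x_a⁴ x_{a′}³ x_i` vanish
  have h43 : ∀ i, i ≠ a → i ≠ a' →
      coeff (Finsupp.single a 4 + Finsupp.single a' 3 + Finsupp.single i 1) (shear a φ (c m).F) = 0 := by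
    intro i hia hia'
    have hdeg : (Finsupp.single a 4 + Finsupp.single a' 3 + Finsupp.single i 1 : Fin 4 →₀ ℕ).degree = 8 := by
      rw [map_add, map_add, Finsupp.degree_single, Finsupp.degree_single, Finsupp.degree_single]
    have hMa : (Finsupp.single a 4 + Finsupp.single a' 3 + Finsupp.single i 1 : Fin 4 →₀ ℕ) a = 4 := by
      rw [Finsupp.add_apply, two_apply haa, if_pos rfl, Finsupp.single_apply, if_neg hia, add_zero]
    have hMa' : (Finsupp.single a 4 + Finsupp.single a' 3 + Finsupp.single i 1 : Fin 4 →₀ ℕ) a' = 3 := by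
      rw [Finsupp.add_apply, two_apply haa, if_neg haa.symm, if_pos rfl, Finsupp.single_apply, if_neg hia', add_zero]
    have hκ : degIn ((Finset.univ.erase a).erase a') (Finsupp.single a 4 + Finsupp.single a' 3 + Finsupp.single i 1) = 1 := by
      have := degree_eq_apply_add_apply_add_degIn haa (Finsupp.single a 4 + Finsupp.single a' 3 + Finsupp.single i 1)
      omega
    have h := h8 _ hdeg (by rw [hPcomm, hκ])
    rw [hJ, coeff_jet_eq_of_noSource haa.symm φ' hφ'a' hφ'a (fun e he hlt hd hc => by
      rw [hdeg] at hlt hc; rw [hMa] at hd; rw [hMa'] at hc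
      obtain ⟨h7, h7eq⟩ := hG7 e he
      have := (h7eq (by omega)).1; omega)] at h
    exact h
  have hdeg45 : (Finsupp.single a 4 + Finsupp.single a' 5 : Fin 4 →₀ ℕ).degree = 9 := by
    rw [map_add, Finsupp.degree_single, Finsupp.degree_single]
  have hdeg44 : (Finsupp.single a 4 + Finsupp.single a' 4 : Fin 4 →₀ ℕ).degree = 8 := by
    rw [map_add, Finsupp.degree_single, Finsupp.degree_single]
  refine ⟨?_, ?_⟩
  · have h := h9 2 le_rfl (by norm_num)
    have hexp : (c m).r + (Finsupp.single a' (6 - 2) + Finsupp.single a 2) =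
        Finsupp.single a 4 + Finsupp.single a' 5 := by
      ext l; rw [hrm, add_comm (Finsupp.single a' (6 - 2)), two_add_two_apply haa, two_apply haa]
    rw [hexp, hJ, coeff_jet_eq_of_noSource haa.symm φ' hφ'a' hφ'a (fun e he hlt hd hc => by
      rw [hdeg45] at hlt hc; rw [two_apply haa, if_pos rfl] at hd
      rw [two_apply haa, if_neg haa.symm, if_pos rfl] at hc
      obtain ⟨h7, h7eq⟩ := hG7 e he
      by_cases h8e : e.degree = 8
      · have hea' : e a' = 3 := by omega
        have hsplit := degree_eq_apply_add_apply_add_degIn haa e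
        obtain ⟨i, hia, hia', hei⟩ := eq_pair_add_single_of_degIn_eq_one haa (e := e) (by omega)
        rw [hea', ← hd] at hei
        exact (MvPolynomial.mem_support_iff.mp he) (by rw [hei]; exact h43 i hia hia')
      · have := (h7eq (by omega)).1; omega)] at h
    exact h
  · have h := h8 _ hdeg44 (by rw [hPcomm, degIn_passive_pair]; omega)
    rw [hJ, coeff_jet_eq_of_noSource haa.symm φ' hφ'a' hφ'a (fun e he hlt hd hc => by
      rw [hdeg44] at hlt hc; rw [two_apply haa, if_pos rfl] at hd
      obtain ⟨h7, h7eq⟩ := hG7 e he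
      have := (h7eq (by omega)).1; omega)] at h
    exact h

end TiltedCorner

end ResCone

end Summit.ResolutionOfSingularities.ResolutionOfSingularities.Theorems.PIDim4

end
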